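import Summits.CriticalPhenomena.PercolationContinuityZ3.Theorems.PercNearOneGluingAdditiveGluingBasePeel
import HarnessLib

/-!
# Glue congruence: two sets of sure pairs that connect the surviving vertices in the same way give the same reliabilities
# (`NoHeavyLowerTail` cell, stmt-CriticalPhenomena-4575; prover `prim-hp-2`, gen 18 — brick L3a of the semantic layer of THEOREM B,
# memo `run/shared/lean/prim/prim-hp-2/MEMO-gen17-lean-certificates.md` §4')

Support file (`--supports stmt-CriticalPhenomena-4575`).  Small computable definitions (edge lists on abstract vertices, their
image in `Fin n`, a parent-pointer CERTIFICATE format) + soundness theorems; no named facts, no sorries.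

* `reachable_union_transfer` — walk surgery: if `ω` has no open pair at the vertices of `V` and every `D`-connection between
  vertices off `V` is a `D'`-connection, then every `(ω ∪ D)`-connection between vertices off `V` is an `(ω ∪ D')`-connection.
* `real_openConn_glue_congr` — for weights `K` vanishing at `V` (the vertices of `V` are killed) and finite sets of pairs `D, D'`
  inducing the same connectivity relation on the vertices off `V`:  `μ_{K[D ↦ 1]}(p ↔ q) = μ_{K[D' ↦ 1]}(p ↔ q)` for `p, q ∉ V`
  (`glueSet_pushforward` + the walk surgery off the null set "some open pair meets `V`").
* Certificates.  `cimg φ E` = the pairs `s(φ i, φ j)`, `(i,j) ∈ E`, of an abstract edge list `E : List (ℕ × ℕ)` on vertices `< N`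
  placed by `φ : ℕ → Fin n` (injective below `N`).  A parent map `par : ℕ → ℕ` with `parOK` (each vertex points to itself or to a
  neighbour) and `labOK` (the `N`-th iterate `root` of `par` is constant along edges) certifies connectivity: `reachable_of_root_eq`
  (equal roots ⇒ joined in `cimg φ E`), `root_eq_of_reachable` (joined ⇒ equal roots), `eq_of_reachable_offRange` (a vertex outside
  `φ[0,N)` is joined to nobody); `reachable_iff_of_cert` packages them: two certified edge lists whose roots induce the same partition of
  the index list `P` have the same connectivity between vertices that avoid `φ([0,N) ∖ P)`.
The sequel `…KNGoodGMgcSideGlue.lean` instantiates this with the twelve side edges of THEOREM B's `K` (three pendant stars and their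
inner pairs) against the glue sets of `sideWorld`, checking the certificates for all `2¹²` side configurations by evaluation.
-/

noncomputable section

namespace Summit.CriticalPhenomena.PercolationContinuityZ3.Theorems

namespace KNGoodGMgc

open MeasureTheory Set Literature.Probability.LatticeModels Literature.Probability.Percolation
open scoped Classical

variable {n : ℕ}

/-! ## Walk surgery -/

/-- **Walk surgery.**  `ω` has no open pair at `V`; every `D`-connection between two vertices off `V` is a `D'`-connection; then every
`(ω ∪ D)`-connection between vertices off `V` is an `(ω ∪ D')`-connection.  (Invariant along the walk: a vertex `c ∉ V` joined to the
start in `ω ∪ D'` from which the current vertex is `D`-reachable.) [folklore] -/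
theorem reachable_union_transfer (ω : BondConfig (Fin n)) (V : Set (Fin n)) (D D' : Set (Sym2 (Fin n)))
    (hω : ∀ e ∈ ω, ∀ v ∈ e, v ∉ V)
    (hDD' : ∀ c₁ c₂ : Fin n, c₁ ∉ V → c₂ ∉ V →
      (openGraph (D : BondConfig (Fin n))).Reachable c₁ c₂ → (openGraph (D' : BondConfig (Fin n))).Reachable c₁ c₂)
    {p q : Fin n} (hp : p ∉ V) (hq : q ∉ V)
    (h : (openGraph (ω ∪ D : BondConfig (Fin n))).Reachable p q) :
    (openGraph (ω ∪ D' : BondConfig (Fin n))).Reachable p q := by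
  obtain ⟨w⟩ := h
  have hmonoD' : openGraph (D' : BondConfig (Fin n)) ≤ openGraph (ω ∪ D' : BondConfig (Fin n)) :=
    openGraph_mono subset_union_right
  have hmonoω : openGraph ω ≤ openGraph (ω ∪ D' : BondConfig (Fin n)) := openGraph_mono subset_union_left
  suffices key : ∀ (u v : Fin n) (r : (openGraph (ω ∪ D : BondConfig (Fin n))).Walk u v),
      (∃ c : Fin n, c ∉ V ∧ (openGraph (ω ∪ D' : BondConfig (Fin n))).Reachable p c ∧
        (openGraph (D : BondConfig (Fin n))).Reachable c u) →
      (∃ c : Fin n, c ∉ V ∧ (openGraph (ω ∪ D' : BondConfig (Fin n))).Reachable p c ∧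
        (openGraph (D : BondConfig (Fin n))).Reachable c v) by
    obtain ⟨c, hc, hpc, hcq⟩ := key p q w ⟨p, hp, SimpleGraph.Reachable.refl _, SimpleGraph.Reachable.refl _⟩
    exact hpc.trans ((hDD' c q hc hq hcq).mono hmonoD')
  intro u v r
  induction r with
  | nil => exact id
  | cons hadj r ih =>
    intro hu
    refine ih ?_
    rename_i u' w' _
    obtain ⟨c, hc, hpc, hcu⟩ := hu
    obtain ⟨hmem, hne⟩ := (openGraph_adj _ u' w').1 hadj
    rcases hmem with hωe | hDe
    · -- an `ω`-step: both ends are off `V`; move the base point to `w'`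
      have hu' : u' ∉ V := hω _ hωe u' (Sym2.mem_mk_left u' w')
      have hw' : w' ∉ V := hω _ hωe w' (Sym2.mem_mk_right u' w')
      have h1 : (openGraph (ω ∪ D' : BondConfig (Fin n))).Reachable p u' := hpc.trans ((hDD' c u' hc hu' hcu).mono hmonoD')
      have h2 : (openGraph (ω ∪ D' : BondConfig (Fin n))).Adj u' w' := hmonoω ((openGraph_adj ω u' w').2 ⟨hωe, hne⟩)
      exact ⟨w', hw', h1.trans h2.reachable, SimpleGraph.Reachable.refl _⟩
    · -- a `D`-step: keep the base point
      exact ⟨c, hc, hpc, hcu.trans ((openGraph_adj (D : BondConfig (Fin n)) u' w').2 ⟨hDe, hne⟩).reachable⟩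

/-! ## Probability: glue congruence -/

/-- Under weights vanishing at the vertices of `V`, almost surely no open pair meets `V`. [folklore] -/
theorem real_exists_openAt_eq_zero (K : Sym2 (Fin n) → unitInterval) (V : Finset (Fin n))
    (hK : ∀ e : Sym2 (Fin n), (∃ v ∈ V, v ∈ e) → K e = 0) :
    (prodBernoulli K).real {ω : BondConfig (Fin n) | ∃ e ∈ ω, ∃ v ∈ V, v ∈ e} = 0 := by
  set F : Finset (Sym2 (Fin n)) := Finset.univ.filter (fun e => ∃ v ∈ V, v ∈ e) with hF
  have hsub : {ω : BondConfig (Fin n) | ∃ e ∈ ω, ∃ v ∈ V, v ∈ e} ⊆ {ω | ∃ e ∈ F, e ∈ ω} := by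
    rintro ω ⟨e, he, hv⟩
    exact ⟨e, Finset.mem_filter.2 ⟨Finset.mem_univ _, hv⟩, he⟩
  apply le_antisymm _ measureReal_nonneg
  calc (prodBernoulli K).real {ω : BondConfig (Fin n) | ∃ e ∈ ω, ∃ v ∈ V, v ∈ e}
      ≤ (prodBernoulli K).real {ω | ∃ e ∈ F, e ∈ ω} := measureReal_mono hsub (measure_ne_top _ _)
    _ ≤ ∑ e ∈ F, (K e : ℝ) := prodBernoulli_real_exists_mem_le_sum K F
    _ = 0 := Finset.sum_eq_zero fun e he => by rw [hK e (Finset.mem_filter.1 he).2]; rfl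

/-- Two events that agree off a null set have the same probability. [folklore] -/
theorem real_eq_of_inter_compl_eq (μ : Measure (BondConfig (Fin n))) [IsFiniteMeasure μ] (A B N : Set (BondConfig (Fin n)))
    (hN : μ.real N = 0) (h : A ∩ Nᶜ = B ∩ Nᶜ) : μ.real A = μ.real B := by
  have hA := measureReal_inter_add_sdiff (μ := μ) (s := A) (t := Nᶜ) MeasurableSet.of_discrete (measure_ne_top _ _)
  have hB := measureReal_inter_add_sdiff (μ := μ) (s := B) (t := Nᶜ) MeasurableSet.of_discrete (measure_ne_top _ _)
  have hsubA : A \ Nᶜ ⊆ N := fun x hx => not_not.1 hx.2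
  have hsubB : B \ Nᶜ ⊆ N := fun x hx => not_not.1 hx.2
  have hAN : μ.real (A \ Nᶜ) = 0 :=
    le_antisymm ((measureReal_mono hsubA (measure_ne_top _ _)).trans hN.le) measureReal_nonneg
  have hBN : μ.real (B \ Nᶜ) = 0 :=
    le_antisymm ((measureReal_mono hsubB (measure_ne_top _ _)).trans hN.le) measureReal_nonneg
  rw [← hA, ← hB, hAN, hBN, h]

/-- **Glue congruence.**  `K` vanishes at the vertices of `V`; `D, D'` are finite sets of pairs such that, on the vertices off `V`, being
joined by pairs of `D` and being joined by pairs of `D'` are the same relation.  Then for `p, q ∉ V`: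
`μ_{K[D ↦ 1]}(p ↔ q) = μ_{K[D' ↦ 1]}(p ↔ q)`.  (Gluing is the push-forward `ω ↦ ω ∪ D`; almost surely no open pair meets `V`, and on that
event the two pulled-back connection events coincide by `reachable_union_transfer`.) [folklore] -/
theorem real_openConn_glue_congr (K : Sym2 (Fin n) → unitInterval) (V : Finset (Fin n))
    (hK : ∀ e : Sym2 (Fin n), (∃ v ∈ V, v ∈ e) → K e = 0) (D D' : Finset (Sym2 (Fin n)))
    (hDD' : ∀ c₁ c₂ : Fin n, c₁ ∉ V → c₂ ∉ V →
      ((openGraph (↑D : BondConfig (Fin n))).Reachable c₁ c₂ ↔ (openGraph (↑D' : BondConfig (Fin n))).Reachable c₁ c₂))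
    (p q : Fin n) (hp : p ∉ V) (hq : q ∉ V) :
    (prodBernoulli (fun f : Sym2 (Fin n) => if f ∈ D then 1 else K f)).real (openConn p q) =
      (prodBernoulli (fun f : Sym2 (Fin n) => if f ∈ D' then 1 else K f)).real (openConn p q) := by
  rw [glueSet_pushforward K (fun f : Sym2 (Fin n) => if f ∈ D then 1 else K f) ↑D
      (fun f hf => by simp [Finset.mem_coe.1 hf]) (fun f hf => by
        have : f ∉ D := fun h => hf (Finset.mem_coe.2 h)
        simp [this]) (openConn p q),
    glueSet_pushforward K (fun f : Sym2 (Fin n) => if f ∈ D' then 1 else K f) ↑D'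
      (fun f hf => by simp [Finset.mem_coe.1 hf]) (fun f hf => by
        have : f ∉ D' := fun h => hf (Finset.mem_coe.2 h)
        simp [this]) (openConn p q)]
  haveI : IsProbabilityMeasure (prodBernoulli K) := inferInstance
  refine real_eq_of_inter_compl_eq (prodBernoulli K) _ _ {ω : BondConfig (Fin n) | ∃ e ∈ ω, ∃ v ∈ V, v ∈ e}
    (real_exists_openAt_eq_zero K V hK) ?_
  have hV : ∀ ω : BondConfig (Fin n), ω ∉ {ω : BondConfig (Fin n) | ∃ e ∈ ω, ∃ v ∈ V, v ∈ e} →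
      ∀ e ∈ ω, ∀ v ∈ e, v ∉ (↑V : Set (Fin n)) := by
    intro ω hω e he v hv hvV
    exact hω ⟨e, he, v, Finset.mem_coe.1 hvV, hv⟩
  have hp' : p ∉ (↑V : Set (Fin n)) := fun h => hp (Finset.mem_coe.1 h)
  have hq' : q ∉ (↑V : Set (Fin n)) := fun h => hq (Finset.mem_coe.1 h)
  ext ω
  simp only [mem_inter_iff, mem_compl_iff]
  constructor
  · rintro ⟨h, hN⟩
    refine ⟨?_, hN⟩
    exact reachable_union_transfer ω ↑V ↑D ↑D' (hV ω hN)
      (fun c₁ c₂ h₁ h₂ => (hDD' c₁ c₂ (fun h => h₁ (Finset.mem_coe.2 h)) (fun h => h₂ (Finset.mem_coe.2 h))).1) hp' hq' h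
  · rintro ⟨h, hN⟩
    refine ⟨?_, hN⟩
    exact reachable_union_transfer ω ↑V ↑D' ↑D (hV ω hN)
      (fun c₁ c₂ h₁ h₂ => (hDD' c₁ c₂ (fun h => h₁ (Finset.mem_coe.2 h)) (fun h => h₂ (Finset.mem_coe.2 h))).2) hp' hq' h

/-! ## Connectivity certificates for edge lists on abstract vertices -/

/-- Adjacency in an edge list on the abstract vertices `0, 1, 2, …` (unordered pairs). [folklore] -/
def adjL (E : List (ℕ × ℕ)) (i j : ℕ) : Bool := E.any fun e => (e.1 == i && e.2 == j) || (e.1 == j && e.2 == i)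

/-- Every edge of the list has two distinct endpoints below `N`. [folklore] -/
def edgesOK (N : ℕ) (E : List (ℕ × ℕ)) : Bool := E.all fun e => decide (e.1 < N) && decide (e.2 < N) && !(e.1 == e.2)

/-- Admissible parent map: every vertex below `N` points below `N`, to itself or to a neighbour. [folklore] -/
def parOK (N : ℕ) (E : List (ℕ × ℕ)) (par : ℕ → ℕ) : Bool :=
  (List.range N).all fun v => decide (par v < N) && (par v == v || adjL E v (par v))

/-- The `N`-th iterate of the parent map ("root"; the component's root when `par` is a forest of depth `< N`). [folklore] -/
def root (N : ℕ) (par : ℕ → ℕ) (v : ℕ) : ℕ := par^[N] v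

/-- The roots are constant along the edges of the list. [folklore] -/
def labOK (N : ℕ) (E : List (ℕ × ℕ)) (par : ℕ → ℕ) : Bool := E.all fun e => root N par e.1 == root N par e.2

/-- The pairs of `Fin n` over an abstract edge list, the abstract vertices placed by `φ`. [folklore] -/
def cimg (φ : ℕ → Fin n) (E : List (ℕ × ℕ)) : Finset (Sym2 (Fin n)) := (E.map fun e => s(φ e.1, φ e.2)).toFinset

/-- Membership in `cimg`. [folklore] -/
theorem mem_cimg (φ : ℕ → Fin n) (E : List (ℕ × ℕ)) (f : Sym2 (Fin n)) :
    f ∈ cimg φ E ↔ ∃ e ∈ E, s(φ e.1, φ e.2) = f := by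
  simp [cimg, List.mem_toFinset, List.mem_map]

/-- An abstract edge is an open pair of the placed edge set. [folklore] -/
theorem adj_cimg_of_adjL (φ : ℕ → Fin n) (N : ℕ) (hφ : ∀ i j : ℕ, i < N → j < N → φ i = φ j → i = j)
    (E : List (ℕ × ℕ)) (hE : edgesOK N E = true) {i j : ℕ} (h : adjL E i j = true) :
    (openGraph (↑(cimg φ E) : BondConfig (Fin n))).Adj (φ i) (φ j) := by
  obtain ⟨e, heE, he⟩ := List.any_eq_true.1 h
  have hok := List.all_eq_true.1 hE e heE
  simp only [Bool.and_eq_true, decide_eq_true_eq, Bool.not_eq_true', beq_eq_false_iff_ne, ne_eq] at hok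
  obtain ⟨⟨h1, h2⟩, h3⟩ := hok
  have hmem : s(φ e.1, φ e.2) ∈ (↑(cimg φ E) : Set (Sym2 (Fin n))) :=
    Finset.mem_coe.2 ((mem_cimg φ E _).2 ⟨e, heE, rfl⟩)
  simp only [Bool.or_eq_true, Bool.and_eq_true, beq_iff_eq] at he
  rw [openGraph_adj]
  rcases he with ⟨hi, hj⟩ | ⟨hj, hi⟩
  · subst hi; subst hj
    exact ⟨hmem, fun h => h3 (hφ _ _ h1 h2 h)⟩
  · subst hi; subst hj
    exact ⟨by rw [Sym2.eq_swap]; exact hmem, fun h => h3 (hφ _ _ h1 h2 h.symm)⟩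

/-- Following an admissible parent map stays below `N` and inside the component. [folklore] -/
theorem reachable_iterate_par (φ : ℕ → Fin n) (N : ℕ) (hφ : ∀ i j : ℕ, i < N → j < N → φ i = φ j → i = j)
    (E : List (ℕ × ℕ)) (hE : edgesOK N E = true) (par : ℕ → ℕ) (hp : parOK N E par = true) :
    ∀ (t v : ℕ), v < N → par^[t] v < N ∧ (openGraph (↑(cimg φ E) : BondConfig (Fin n))).Reachable (φ v) (φ (par^[t] v))
  | 0, v, hv => ⟨hv, SimpleGraph.Reachable.refl _⟩
  | t + 1, v, hv => by
    obtain ⟨hlt, hr⟩ := reachable_iterate_par φ N hφ E hE par hp t v hv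
    have hv' := List.all_eq_true.1 hp (par^[t] v) (List.mem_range.2 hlt)
    simp only [Bool.and_eq_true, decide_eq_true_eq, Bool.or_eq_true, beq_iff_eq] at hv'
    rw [Function.iterate_succ_apply']
    refine ⟨hv'.1, ?_⟩
    rcases hv'.2 with h | h
    · rw [h]; exact hr
    · exact hr.trans (adj_cimg_of_adjL φ N hφ E hE h).reachable

/-- **Equal roots ⇒ joined.** [folklore] -/
theorem reachable_of_root_eq (φ : ℕ → Fin n) (N : ℕ) (hφ : ∀ i j : ℕ, i < N → j < N → φ i = φ j → i = j)
    (E : List (ℕ × ℕ)) (hE : edgesOK N E = true) (par : ℕ → ℕ) (hp : parOK N E par = true)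
    {v w : ℕ} (hv : v < N) (hw : w < N) (h : root N par v = root N par w) :
    (openGraph (↑(cimg φ E) : BondConfig (Fin n))).Reachable (φ v) (φ w) := by
  have h1 := (reachable_iterate_par φ N hφ E hE par hp N v hv).2
  have h2 := (reachable_iterate_par φ N hφ E hE par hp N w hw).2
  change (openGraph (↑(cimg φ E) : BondConfig (Fin n))).Reachable (φ v) (φ (root N par v)) at h1
  change (openGraph (↑(cimg φ E) : BondConfig (Fin n))).Reachable (φ w) (φ (root N par w)) at h2
  rw [h] at h1
  exact h1.trans h2.symm

/-- **Joined ⇒ equal roots** (the root is constant along edges, hence along walks). [folklore] -/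
theorem root_eq_of_reachable (φ : ℕ → Fin n) (N : ℕ) (hφ : ∀ i j : ℕ, i < N → j < N → φ i = φ j → i = j)
    (E : List (ℕ × ℕ)) (hE : edgesOK N E = true) (par : ℕ → ℕ) (hl : labOK N E par = true)
    {i : ℕ} (hi : i < N) {w : Fin n} (h : (openGraph (↑(cimg φ E) : BondConfig (Fin n))).Reachable (φ i) w) :
    ∃ m : ℕ, m < N ∧ w = φ m ∧ root N par m = root N par i := by
  obtain ⟨r⟩ := h
  suffices key : ∀ (u v : Fin n) (r : (openGraph (↑(cimg φ E) : BondConfig (Fin n))).Walk u v),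
      (∃ m : ℕ, m < N ∧ u = φ m ∧ root N par m = root N par i) → (∃ m : ℕ, m < N ∧ v = φ m ∧ root N par m = root N par i) from
    key _ _ r ⟨i, hi, rfl, rfl⟩
  intro u v r
  induction r with
  | nil => exact id
  | cons hadj r ih =>
    intro hu
    refine ih ?_
    rename_i u' w' _
    obtain ⟨m, hm, rfl, hroot⟩ := hu
    obtain ⟨hmem, -⟩ := (openGraph_adj _ _ w').1 hadj
    obtain ⟨e, heE, he⟩ := (mem_cimg φ E _).1 (Finset.mem_coe.1 hmem)
    have hok := List.all_eq_true.1 hE e heE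
    simp only [Bool.and_eq_true, decide_eq_true_eq, Bool.not_eq_true', beq_eq_false_iff_ne, ne_eq] at hok
    obtain ⟨⟨h1, h2⟩, -⟩ := hok
    have hlab := List.all_eq_true.1 hl e heE
    simp only [beq_iff_eq] at hlab
    rcases Sym2.eq_iff.1 he with ⟨ha, hb⟩ | ⟨ha, hb⟩
    · have : e.1 = m := hφ _ _ h1 hm ha
      subst this
      exact ⟨e.2, h2, hb.symm, by rw [← hlab, hroot]⟩
    · have : e.2 = m := hφ _ _ h2 hm hb
      subst this
      exact ⟨e.1, h1, ha.symm, by rw [hlab, hroot]⟩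

/-- A vertex outside the placed abstract vertices is joined to nobody else by the placed edges. [folklore] -/
theorem eq_of_reachable_offRange (φ : ℕ → Fin n) (N : ℕ) (E : List (ℕ × ℕ)) (hE : edgesOK N E = true)
    {c₁ c₂ : Fin n} (h₁ : ∀ i : ℕ, i < N → c₁ ≠ φ i)
    (h : (openGraph (↑(cimg φ E) : BondConfig (Fin n))).Reachable c₁ c₂) : c₁ = c₂ := by
  obtain ⟨r⟩ := h
  cases r with
  | nil => rfl
  | cons hadj _ =>
    exfalso
    rename_i v _
    obtain ⟨hmem, -⟩ := (openGraph_adj _ c₁ v).1 hadj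
    obtain ⟨e, heE, he⟩ := (mem_cimg φ E _).1 (Finset.mem_coe.1 hmem)
    have hok := List.all_eq_true.1 hE e heE
    simp only [Bool.and_eq_true, decide_eq_true_eq, Bool.not_eq_true', beq_eq_false_iff_ne, ne_eq] at hok
    rcases Sym2.eq_iff.1 he with ⟨ha, -⟩ | ⟨-, hb⟩
    · exact h₁ e.1 hok.1.1 ha.symm
    · exact h₁ e.2 hok.1.2 hb.symm

/-- **Transfer of connectivity between two certified edge lists.**  `D` carries a root labelling constant along its edges, `G` an
admissible parent map; on the index list `P` equal `D`-roots imply equal `G`-roots.  Then every `D`-connection between two vertices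
avoiding `φ([0,N) ∖ P)` is a `G`-connection. [folklore] -/
theorem reachable_transfer_of_cert (φ : ℕ → Fin n) (N : ℕ) (hφ : ∀ i j : ℕ, i < N → j < N → φ i = φ j → i = j)
    (P : List ℕ) (D G : List (ℕ × ℕ)) (parD parG : ℕ → ℕ)
    (hD : edgesOK N D = true) (hG : edgesOK N G = true) (hlD : labOK N D parD = true) (hpG : parOK N G parG = true)
    (hcmp : ∀ i ∈ P, ∀ j ∈ P, root N parD i = root N parD j → root N parG i = root N parG j)
    {c₁ c₂ : Fin n} (h₁ : ∀ i : ℕ, i < N → i ∉ P → c₁ ≠ φ i) (h₂ : ∀ i : ℕ, i < N → i ∉ P → c₂ ≠ φ i)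
    (h : (openGraph (↑(cimg φ D) : BondConfig (Fin n))).Reachable c₁ c₂) :
    (openGraph (↑(cimg φ G) : BondConfig (Fin n))).Reachable c₁ c₂ := by
  by_cases hc : ∃ i : ℕ, i < N ∧ c₁ = φ i
  · obtain ⟨i, hi, rfl⟩ := hc
    have hiP : i ∈ P := by
      by_contra hiP; exact h₁ i hi hiP rfl
    obtain ⟨m, hm, rfl, hroot⟩ := root_eq_of_reachable φ N hφ D hD parD hlD hi h
    have hmP : m ∈ P := by
      by_contra hmP; exact h₂ m hm hmP rfl
    exact reachable_of_root_eq φ N hφ G hG parG hpG hi hm (hcmp i hiP m hmP hroot.symm)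
  · push Not at hc
    rw [eq_of_reachable_offRange φ N D hD (fun i hi h => hc i hi h) h]

/-- **Equivalence of connectivity between two certified edge lists** whose roots induce the same partition of the index list `P`,
for pairs of vertices avoiding `φ([0,N) ∖ P)`. [folklore] -/
theorem reachable_iff_of_cert (φ : ℕ → Fin n) (N : ℕ) (hφ : ∀ i j : ℕ, i < N → j < N → φ i = φ j → i = j)
    (P : List ℕ) (D G : List (ℕ × ℕ)) (parD parG : ℕ → ℕ)
    (hD : edgesOK N D = true) (hG : edgesOK N G = true)
    (hpD : parOK N D parD = true) (hpG : parOK N G parG = true) (hlD : labOK N D parD = true) (hlG : labOK N G parG = true)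
    (hcmp : ∀ i ∈ P, ∀ j ∈ P, (root N parD i == root N parD j) = (root N parG i == root N parG j))
    {c₁ c₂ : Fin n} (h₁ : ∀ i : ℕ, i < N → i ∉ P → c₁ ≠ φ i) (h₂ : ∀ i : ℕ, i < N → i ∉ P → c₂ ≠ φ i) :
    (openGraph (↑(cimg φ D) : BondConfig (Fin n))).Reachable c₁ c₂ ↔
      (openGraph (↑(cimg φ G) : BondConfig (Fin n))).Reachable c₁ c₂ := by
  constructor
  · refine reachable_transfer_of_cert φ N hφ P D G parD parG hD hG hlD hpG (fun i hi j hj hr => ?_) h₁ h₂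
    have := hcmp i hi j hj
    rw [beq_iff_eq.2 hr] at this
    exact beq_iff_eq.1 this.symm
  · refine reachable_transfer_of_cert φ N hφ P G D parG parD hG hD hlG hpD (fun i hi j hj hr => ?_) h₁ h₂
    have := hcmp i hi j hj
    rw [beq_iff_eq.2 hr] at this
    exact beq_iff_eq.1 this

end KNGoodGMgc

end Summit.CriticalPhenomena.PercolationContinuityZ3.Theorems

end
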